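import Summits.PneNP.PneNP.Theorems.ChebyshevTracialDesignCrossingFormsNull
import HarnessLib

/-!
# Cell pnp-psdrank, route `ChebyshevTracialDesign`: CG_1 REDUCES TO THE PAIR-CONTAINMENT FORM — for every mask `f` (`|f| ≤ 1`) and all
# matching-dependent test vectors `v_M` (`|v_M| ≤ 1`):
# `|Σ_M Σ_U W f (v_M·x_U)² − Σ_M Σ_U W f (Σ_p v_M(p)·x_p x_{π_M p})²| ≤ 3n⁴·(Σ|w_c|)·√P_{D−4}` (crux `TracialDecayExp20`, stmt-PneNP-19878)

Brick 101 (prover g18; MEMO-21 §3(c')). Split each coordinate of a cut against a matching `M` into its CONTAINMENT and CROSSING parts,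
`x_p = x_p x_{πp} + x_p(1 − x_{πp})`; the second is supported on the cuts crossed by the edge `{p, πp}`. Hence
`v·x_U = C_M(U) + R_M(U)` with the PAIR-CONTAINMENT FORM `C_M(U) = Σ_p v_p x_p x_{π_M p} = Σ_{e∈M}(v_p + v_{p'})·1[e ⊆ U]` and a crossing
remainder `R_M`, and `(v·x)² − C² = 2CR + R²` is a sum of `3n⁴` signed scalar crossing-pin cells after re-indexing the partners (brick 99 §1
`crossingCell_scalar_abs_le`, brick 24b). THEOREM **`value_sq_sub_containment_abs_le`**: for an exact design `(n, t = 2c'+1, T, D, B_v, C, w)`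
with `4 ≤ D ≤ 2c'`, every `f` with `|f| ≤ 1` and every `v : PM_n → ℝ^n` with `|v_M(p)| ≤ 1`,
`|Σ_M Σ_U W(U,M) f(U) (v_M·x_U)² − Σ_M Σ_U W(U,M) f(U) (Σ_p v_M(p) x_p(U) x_{π_M p}(U))²| ≤ 3n⁴·(Σ_c|w_c|)·√P_{D−4}`.
CONSEQUENCE (with 98–100): the conditional-Grigoriev statement CG_1 of MEMO-21 §3(b) is, up to `e^{−(D/4−O(1))·ln(n/D)}`, EXACTLY the
psd-order statement about the PAIR-PINNED DESIGN-VALUE MATRIX `A^f_M(e,e') = Σ_U W(U,M) f(U)·1[e ∪ e' ⊆ U]` (`e, e' ∈ M`):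
«`Σ_M sup_{|v|≤1} (Σ_{e,e'∈M} v_e v_{e'} A^f_M(e,e'))₊` is `e^{−aD}`-small» — no symmetry hypothesis on `v` is needed, the containment form
symmetrises by itself. For `f ≡ 1`, `A¹_M = −|PM|⁻¹[κ₂J + (κ₁−κ₂)I]` (brick 98). This is the first r-free rung above NTF in its final form.
[cite: Rothvoss2017, §2 and Lemma 7 (PDF pp. 6–8)] [cite: Grigoriev2001, Lemma 1.4 (PDF p. 8)] [cite: GriblingDelaatLaurent2019, §5]
Stature: support/instrument (kernel lane, no defs, axioms standard). WHAT THIS IS NOT: nothing on `A^f_M` itself beyond `f ≡ 1`, no proof or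
refutation of `TracialDecayExp20`, nothing on psd rank of P_PM(K_n), no P-vs-NP content. Supports stmt-PneNP-19878.
-/

set_option linter.dupNamespace false -- `Summit.PneNP.PneNP.…`: summit = sub-problem (D-0017)

noncomputable section

namespace Summit.PneNP.PneNP.Theorems.ChebyshevTracialDesignContainmentReduction

open Finset Matrix Literature.Barriers.PneNP Literature.Combinatorics.Optimization
open Literature.Combinatorics.SimpleGraph.CycleSpace
open Summit.PneNP.PneNP.Theorems.ChebyshevTracialDesignCrossingFormsNull (crossingCell_scalar_abs_le)

variable {n : ℕ}

/-- **CG_1 REDUCES TO THE PAIR-CONTAINMENT FORM.** [cite: Rothvoss2017, §2 and Lemma 7 (PDF pp. 6–8)] [cite: Grigoriev2001, Lemma 1.4 (PDF p. 8)]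
[cite: GriblingDelaatLaurent2019, §5] -/
theorem value_sq_sub_containment_abs_le {c' T D : ℕ} {Bv : ℝ} {C : Finset ℕ} {w : ℕ → ℝ} (hn : Even n)
    (hdes : IsExactDesign n (2 * c' + 1) T D Bv C w) (hD : D ≤ 2 * c') (hD4 : 4 ≤ D)
    (f : OddSet n → ℝ) (hf : ∀ U, |f U| ≤ 1) (v : PMatch n → Fin n → ℝ) (hv1 : ∀ M p, |v M p| ≤ 1) :
    |∑ M : PMatch n, ∑ U : OddSet n, levelWeight n (2 * c' + 1) C w U M *
          (f U * (∑ p, v M p * (if p ∈ U.1 then (1 : ℝ) else 0)) ^ 2) -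
        ∑ M : PMatch n, ∑ U : OddSet n, levelWeight n (2 * c' + 1) C w U M *
          (f U * (∑ p, v M p * ((if p ∈ U.1 then (1 : ℝ) else 0) * (if M.2.partner p ∈ U.1 then (1 : ℝ) else 0))) ^ 2)| ≤
      3 * (n : ℝ) ^ 4 * ((∑ c ∈ C, |w c|) * Real.sqrt (∏ i ∈ range ((D - 4) / 2 + 1), ((2 * i + 1 : ℝ) / ((n : ℝ) - 2 * i)))) := by
  classical
  set β : ℝ := (∑ c ∈ C, |w c|) * Real.sqrt (∏ i ∈ range ((D - 4) / 2 + 1), ((2 * i + 1 : ℝ) / ((n : ℝ) - 2 * i))) with hβ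
  have hβ0 : 0 ≤ β := mul_nonneg (sum_nonneg fun c _ => abs_nonneg _) (Real.sqrt_nonneg _)
  set x : OddSet n → Fin n → ℝ := fun U p => if p ∈ U.1 then (1 : ℝ) else 0 with hx
  -- containment and crossing parts of a coordinate
  set γ : Fin n → Fin n → OddSet n → ℝ := fun p p' U => x U p * x U p' with hγ
  set κ : Fin n → Fin n → OddSet n → ℝ := fun p p' U => x U p * (1 - x U p') with hκ
  have hγ1 : ∀ p p' U, |γ p p' U| ≤ 1 := fun p p' U => by rw [hγ, hx]; dsimp only; split_ifs <;> norm_num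
  have hκ1 : ∀ p p' U, |κ p p' U| ≤ 1 := fun p p' U => by rw [hκ, hx]; dsimp only; split_ifs <;> norm_num
  have hκcross : ∀ p p' (U : OddSet n), ¬ Crosses U.1 s(p, p') → κ p p' U = 0 := by
    intro p p' U hU
    rw [crosses_mk] at hU
    rw [hκ, hx]; dsimp only
    by_cases hp : p ∈ U.1
    · by_cases hp' : p' ∈ U.1
      · simp [hp, hp']
      · exact absurd (Or.inl ⟨hp, hp'⟩) hU
    · simp [hp]
  have hsplit : ∀ U p p', x U p = γ p p' U + κ p p' U := fun U p p' => by rw [hγ, hκ]; ring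
  -- the two families of cells, indexed by `c = ((p,q),(p',q'))`
  set T1 : (Fin n × Fin n) × (Fin n × Fin n) → OddSet n → PMatch n → ℝ := fun c U M =>
    levelWeight n (2 * c' + 1) C w U M *
      ((f U * (κ c.1.1 c.2.1 U * γ c.1.2 c.2.2 U)) *
        (if (M.2.partner c.1.1 = c.2.1 ∧ M.2.partner c.1.2 = c.2.2) then v M c.1.1 * v M c.1.2 else 0)) with hT1
  set T2 : (Fin n × Fin n) × (Fin n × Fin n) → OddSet n → PMatch n → ℝ := fun c U M =>
    levelWeight n (2 * c' + 1) C w U M *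
      ((f U * (κ c.1.1 c.2.1 U * κ c.1.2 c.2.2 U)) *
        (if (M.2.partner c.1.1 = c.2.1 ∧ M.2.partner c.1.2 = c.2.2) then v M c.1.1 * v M c.1.2 else 0)) with hT2
  -- Step 1: pointwise identity `(v·x)² − C² = 2 Σ_c [κγ-terms] + Σ_c [κκ-terms]` after re-indexing
  have hreidx : ∀ (M : PMatch n) (U : OddSet n) (G : Fin n → Fin n → Fin n → Fin n → ℝ),
      ∑ a : Fin n × Fin n, v M a.1 * v M a.2 * G a.1 (M.2.partner a.1) a.2 (M.2.partner a.2) =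
        ∑ c : (Fin n × Fin n) × (Fin n × Fin n),
          G c.1.1 c.2.1 c.1.2 c.2.2 * (if (M.2.partner c.1.1 = c.2.1 ∧ M.2.partner c.1.2 = c.2.2) then v M c.1.1 * v M c.1.2 else 0) := by
    intro M U G
    rw [Fintype.sum_prod_type (f := fun c : (Fin n × Fin n) × (Fin n × Fin n) =>
      G c.1.1 c.2.1 c.1.2 c.2.2 * (if (M.2.partner c.1.1 = c.2.1 ∧ M.2.partner c.1.2 = c.2.2) then v M c.1.1 * v M c.1.2 else 0))]
    refine sum_congr rfl fun a _ => ?_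
    rw [Fintype.sum_eq_single (M.2.partner a.1, M.2.partner a.2)]
    · simp only [and_self, if_true]; ring
    · intro b hb
      rw [if_neg, mul_zero]
      rintro ⟨h1, h2⟩
      exact hb (Prod.ext h1.symm h2.symm)
  have hpoint : ∀ (M : PMatch n) (U : OddSet n),
      levelWeight n (2 * c' + 1) C w U M * (f U * (∑ p, v M p * x U p) ^ 2) -
        levelWeight n (2 * c' + 1) C w U M * (f U * (∑ p, v M p * (x U p * x U (M.2.partner p))) ^ 2) =
      2 * ∑ c : (Fin n × Fin n) × (Fin n × Fin n), T1 c U M + ∑ c : (Fin n × Fin n) × (Fin n × Fin n), T2 c U M := by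
    intro M U
    -- `v·x = Cc + R`
    have hCR : ∑ p, v M p * x U p = ∑ p, v M p * γ p (M.2.partner p) U + ∑ p, v M p * κ p (M.2.partner p) U := by
      rw [← sum_add_distrib]; exact sum_congr rfl fun p _ => by rw [hsplit U p (M.2.partner p)]; ring
    have hCc : ∑ p, v M p * (x U p * x U (M.2.partner p)) = ∑ p, v M p * γ p (M.2.partner p) U := by
      rfl
    rw [hCR, hCc]
    set Cc := ∑ p, v M p * γ p (M.2.partner p) U
    set R := ∑ p, v M p * κ p (M.2.partner p) U
    -- `2·Cc·R` and `R²` as sums over pairs, then re-indexed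
    have hRC : R * Cc = ∑ a : Fin n × Fin n, v M a.1 * v M a.2 * (κ a.1 (M.2.partner a.1) U * γ a.2 (M.2.partner a.2) U) := by
      rw [sum_mul_sum, ← Finset.univ_product_univ, sum_product]
      exact sum_congr rfl fun p _ => sum_congr rfl fun q _ => by ring
    have hRR : R * R = ∑ a : Fin n × Fin n, v M a.1 * v M a.2 * (κ a.1 (M.2.partner a.1) U * κ a.2 (M.2.partner a.2) U) := by
      rw [sum_mul_sum, ← Finset.univ_product_univ, sum_product]
      exact sum_congr rfl fun p _ => sum_congr rfl fun q _ => by ring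
    rw [hreidx M U (fun p p' q q' => κ p p' U * γ q q' U)] at hRC
    rw [hreidx M U (fun p p' q q' => κ p p' U * κ q q' U)] at hRR
    have e1 : ∑ c : (Fin n × Fin n) × (Fin n × Fin n), T1 c U M =
        levelWeight n (2 * c' + 1) C w U M * (f U * (R * Cc)) := by
      rw [hRC, mul_sum, mul_sum]; exact sum_congr rfl fun c _ => by rw [hT1]; ring
    have e2 : ∑ c : (Fin n × Fin n) × (Fin n × Fin n), T2 c U M =
        levelWeight n (2 * c' + 1) C w U M * (f U * (R * R)) := by
      rw [hRR, mul_sum, mul_sum]; exact sum_congr rfl fun c _ => by rw [hT2]; ring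
    rw [e1, e2]; ring
  -- Step 2: the difference as `2 Σ_c Σ_U Σ_M T1 + Σ_c Σ_U Σ_M T2`
  have hswap : ∀ T : (Fin n × Fin n) × (Fin n × Fin n) → OddSet n → PMatch n → ℝ,
      ∑ M : PMatch n, ∑ U : OddSet n, ∑ c, T c U M = ∑ c, ∑ U : OddSet n, ∑ M : PMatch n, T c U M := by
    intro T
    calc ∑ M : PMatch n, ∑ U : OddSet n, ∑ c, T c U M = ∑ M : PMatch n, ∑ c, ∑ U : OddSet n, T c U M :=
          sum_congr rfl fun M _ => sum_comm
      _ = ∑ c, ∑ M : PMatch n, ∑ U : OddSet n, T c U M := sum_comm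
      _ = ∑ c, ∑ U : OddSet n, ∑ M : PMatch n, T c U M := sum_congr rfl fun c _ => sum_comm
  have hdiff : ∑ M : PMatch n, ∑ U : OddSet n, levelWeight n (2 * c' + 1) C w U M * (f U * (∑ p, v M p * x U p) ^ 2) -
        ∑ M : PMatch n, ∑ U : OddSet n, levelWeight n (2 * c' + 1) C w U M * (f U * (∑ p, v M p * (x U p * x U (M.2.partner p))) ^ 2) =
      2 * ∑ c, ∑ U : OddSet n, ∑ M : PMatch n, T1 c U M + ∑ c, ∑ U : OddSet n, ∑ M : PMatch n, T2 c U M := by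
    rw [← hswap T1, ← hswap T2, ← sum_sub_distrib, mul_sum, ← sum_add_distrib]
    refine sum_congr rfl fun M _ => ?_
    rw [← sum_sub_distrib, mul_sum, ← sum_add_distrib]
    exact sum_congr rfl fun U _ => hpoint M U
  -- Step 3: each cell
  have hy : ∀ (c : (Fin n × Fin n) × (Fin n × Fin n)) (M : PMatch n), s(c.1.1, c.2.1) ∉ M.1 →
      (if (M.2.partner c.1.1 = c.2.1 ∧ M.2.partner c.1.2 = c.2.2) then v M c.1.1 * v M c.1.2 else 0) = 0 := by
    intro c M hM
    rw [if_neg]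
    rintro ⟨hp, -⟩
    exact hM (hp ▸ M.2.mk_partner_mem c.1.1)
  have hy1 : ∀ (c : (Fin n × Fin n) × (Fin n × Fin n)) (M : PMatch n),
      |(if (M.2.partner c.1.1 = c.2.1 ∧ M.2.partner c.1.2 = c.2.2) then v M c.1.1 * v M c.1.2 else 0)| ≤ 1 := by
    intro c M
    split_ifs
    · rw [abs_mul]; have := hv1 M c.1.1; have := hv1 M c.1.2; nlinarith [abs_nonneg (v M c.1.1), abs_nonneg (v M c.1.2)]
    · rw [abs_zero]; exact zero_le_one
  have hcell1 : ∀ c : (Fin n × Fin n) × (Fin n × Fin n), |∑ U : OddSet n, ∑ M : PMatch n, T1 c U M| ≤ β := by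
    intro c
    rw [hT1]
    refine crossingCell_scalar_abs_le hn hdes hD hD4 c.1.1 c.2.1 (fun U => f U * (κ c.1.1 c.2.1 U * γ c.1.2 c.2.2 U)) (fun U hU => ?_)
      (fun U => ?_) _ (hy c) (hy1 c)
    · rw [hκcross _ _ U hU, zero_mul, mul_zero]
    · rw [abs_mul, abs_mul]
      have h1 := hf U; have h2 := hκ1 c.1.1 c.2.1 U; have h3 := hγ1 c.1.2 c.2.2 U
      nlinarith [abs_nonneg (f U), abs_nonneg (κ c.1.1 c.2.1 U), abs_nonneg (γ c.1.2 c.2.2 U),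
        mul_nonneg (abs_nonneg (κ c.1.1 c.2.1 U)) (abs_nonneg (γ c.1.2 c.2.2 U))]
  have hcell2 : ∀ c : (Fin n × Fin n) × (Fin n × Fin n), |∑ U : OddSet n, ∑ M : PMatch n, T2 c U M| ≤ β := by
    intro c
    rw [hT2]
    refine crossingCell_scalar_abs_le hn hdes hD hD4 c.1.1 c.2.1 (fun U => f U * (κ c.1.1 c.2.1 U * κ c.1.2 c.2.2 U)) (fun U hU => ?_)
      (fun U => ?_) _ (hy c) (hy1 c)
    · rw [hκcross _ _ U hU, zero_mul, mul_zero]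
    · rw [abs_mul, abs_mul]
      have h1 := hf U; have h2 := hκ1 c.1.1 c.2.1 U; have h3 := hκ1 c.1.2 c.2.2 U
      nlinarith [abs_nonneg (f U), abs_nonneg (κ c.1.1 c.2.1 U), abs_nonneg (κ c.1.2 c.2.2 U),
        mul_nonneg (abs_nonneg (κ c.1.1 c.2.1 U)) (abs_nonneg (κ c.1.2 c.2.2 U))]
  have hcard : ∀ g : (Fin n × Fin n) × (Fin n × Fin n) → ℝ, (∀ c, |g c| ≤ β) → |∑ c, g c| ≤ (n : ℝ) ^ 4 * β := by
    intro g hg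
    calc |∑ c, g c| ≤ ∑ c : (Fin n × Fin n) × (Fin n × Fin n), β := (abs_sum_le_sum_abs _ _).trans (sum_le_sum fun c _ => hg c)
      _ = (n : ℝ) ^ 4 * β := by
          rw [sum_const, card_univ, Fintype.card_prod, Fintype.card_prod, Fintype.card_fin, nsmul_eq_mul]; push_cast; ring
  -- Step 4: add up
  rw [hdiff]
  have h1 := hcard _ hcell1
  have h2 := hcard _ hcell2
  calc _ ≤ |2 * ∑ c, ∑ U : OddSet n, ∑ M : PMatch n, T1 c U M| + |∑ c, ∑ U : OddSet n, ∑ M : PMatch n, T2 c U M| := abs_add_le _ _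
    _ ≤ 2 * ((n : ℝ) ^ 4 * β) + (n : ℝ) ^ 4 * β := by
        rw [abs_mul, abs_of_pos (by norm_num : (0 : ℝ) < 2)]
        exact add_le_add (mul_le_mul_of_nonneg_left h1 (by norm_num)) h2
    _ = 3 * (n : ℝ) ^ 4 * β := by ring

end Summit.PneNP.PneNP.Theorems.ChebyshevTracialDesignContainmentReduction

end
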